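import Literature.AnabelianGeometry.EtaleTheta.Discharge.Sec5Rho219Pin
import Literature.AnabelianGeometry.EtaleTheta.Discharge.Sec5Prop55EtaTautological

/-!
# [EtTh] Lemma 5.9 (v), pinned slot: the `Δ`-leg law and the coverage REDUCED to the row-2 laws of the
# theta subquotient datum + «`B_N` is an `l·N`-codomain» (proof-only)

Mochizuki, *The étale theta function and its Frobenioid-theoretic manifestations*, Publ. RIMS **45** (2009),
Lemma 5.9 (v) p.332 (PDF p.106), proof of Prop. 5.5 pp.327–328 (PDF pp.101–102), §1 p.238 (PDF p.12)
[cite: MochizukiEtTh2009, Lem 5.9 (v) p.332 (PDF p.106)].  abc-iut cell, layer L2, seat abc-iut-w4-d042 (gen 2);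
PROOF-ONLY sequel (0 definitions, 0 named facts) of `Sec5Rho219Pin.lean` (p419122, MERGE-PLAN row 10 pin
`rho219OfBiTheta`), aligning its two binders with the binders of abc-iut-w5-d123's Prop. 5.5 / Thm. 5.6 (i) closers
(`Sec5Prop55EtaTautological.lean` p418694, `Sec5LDeltaCovered.lean` p419020) — ONE residual, two consumers:

* `isDeltaLeg_of_laws` — the `Δ`-leg law `IsDeltaLeg` (stated in `Sec5Rho219Pin` for ALL `y ∈ Π^tp_Ÿ̲` over `Δ` with
  `ρ y` in the theta pre-subgroup) FOLLOWS from the binders of w5-d123's `exists_eta_etaTautological_ofBiKummerData`,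
  written for an ARBITRARY §5 datum `𝔉` with identification `ι` and `e := ψ⁻¹`: (hlift) «an element of `H_{B_N}` in the
  theta pre-subgroup lifts to `Π^tp_Ÿ̲ ∩ ι⁻¹θ⁻¹(l·Δ_Θ)`» and (hP) «`P.proj ∘ ρ = ψ⁻¹ ∘ θ-mod ∘ ι` there» (MERGE-PLAN row 2 /
  GAP G-w5d123-2), and (hdies) «the mod-`N` theta cocycle dies on `Ker(ρ ∘ ι⁻¹) ∩ Π^tp_Ÿ`» — `B_N` is an `l·N`-codomain
  (GAP G-w5d123-1; abc-iut-L6-t23's `Sec5RootCocycleDiesOnBN` gives its shape) — via w5-d123's fibre-constancy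
  `ThetaEnvData.thetaCocycle_eq_of_map_eq` and L2-t2's `RigidData.cocycle_lDeltaTheta`.  So `IsDeltaLeg` is NOT a
  stronger reading than the Prop. 5.5 chain's: it is (hlift) + (hP) + (hdies).
* `cover_of_laws` — the coverage binder `hcov` of `cycRigidityCoincide_rho219OfBiTheta` FOLLOWS from (hP) and
  (hpre) «`ρ(Π^tp_Ÿ̲ ∩ ι⁻¹θ⁻¹(l·Δ_Θ)) ⊆ P.pre`» by «`θ-mod` is onto `μ_N`» (`RigidData.thetaMod_surjective`, §1 p.238
  «`Δ_Θ` is a quotient of a subgroup of `Π^tp_Ÿ`») — the same argument as w5-d123's `lDeltaCovered_ofBiKummerData`,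
  for an ARBITRARY §5 datum `𝔉` and identification `ι`.
* `cycRigidityCoincide_rho219OfBiTheta_of_laws` — hence L2-t4's `CycRigidityCoincide (rho219OfBiTheta …) ρ hB` from
  Prop. 5.5 BY NAME (`IsKummerDetermined`) + (hpre, hlift, hP, hdies) + the bi-theta isomorphism of Lemma 5.9 (iv):
  the SAME binder list as the Prop. 5.5 / Thm. 5.6 (i) chain (w5-d020 `thm56_i_of_kummerDetermined`, w5-d123).
HONEST FRAMING: [EtTh] refereed; binders named, nothing asserted; no side taken on [IUTchIII] Cor. 3.12; typed ≠ proved.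
-/

noncomputable section

namespace Literature.AnabelianGeometry.EtaleTheta

open CategoryTheory
open FrobenioidCyclotomicRigidity

universe w v v' u u'

namespace ThetaFrobenioid

variable {C : Type u} [Category.{v} C] {D : Type u'} [Category.{v'} D] (𝔉 : ThetaFrobenioid.{w} C D)
  (h1 : 𝔉.SectionsFactor) (h3 : 𝔉.OuterActionLZ) (hsec : 𝔉.SgpCapSection) (hcs : 𝔉.SgpCupSection)
  (h8 : 𝔉.ConstantsEqNormalizer) (DK : Set (TopOut 𝔉.EPiN))
  {l : ℕ} (R : RigidData.{v} 𝔉.N l) (ι : 𝔉.PiX ≃ₜ* R.PiX)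

/-- `ι⁻¹` carries `Π^tp_Ÿ` into `Π^tp_Ÿ̲` (elementwise inverse of `hYdd`). [cite: MochizukiEtTh2009, Lem 5.9 (iv) p.332 (PDF p.106)] -/
theorem iota_symm_mem_PiYdd (hYdd : 𝔉.PiYdd.map ι.toMonoidHom = R.PiYdd) (k : R.PiYdd) : ι.symm (k : R.PiX) ∈ 𝔉.PiYdd := by
  have hk : (k : R.PiX) ∈ 𝔉.PiYdd.map ι.toMonoidHom := by rw [hYdd]; exact k.2
  obtain ⟨y, hy, hyk⟩ := hk
  have : ι.symm (k : R.PiX) = y := by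
    rw [← hyk]
    exact ι.symm_apply_apply y
  rw [this]
  exact hy

/-- **The `Δ`-leg law from the row-2 laws + «`B_N` is an `l·N`-codomain».**  If (hlift) every element of `H_{B_N}`
in the theta pre-subgroup is `ρ k` for some `k ∈ Π^tp_Ÿ̲` with `ι k ∈ θ⁻¹(l·Δ_Θ)`, (hP) `[P.proj(ρ k)] = ψ⁻¹(θ-mod(ι k))`
for such `k`, and (hdies) the theta cocycle `η` dies on `Ker(ρ ∘ ι⁻¹) ∩ Π^tp_Ÿ`, then `IsDeltaLeg ι η P ψ`
(`ψ[P.proj(ρ y)] = η(ι y)` for ALL `y ∈ Π^tp_Ÿ̲` over `Δ` with `ρ y` in the pre-subgroup): `ρ y = ρ k`,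
`θ-mod(ι k) = η(ι k)` (`RigidData.cocycle_lDeltaTheta`) and `η(ι k) = η(ι y)` by fibre-constancy
(`ThetaEnvData.thetaCocycle_eq_of_map_eq`, w5-d123) — w5-d123's `etaTautological_ofBiKummerData` argument verbatim.
[cite: MochizukiEtTh2009, Prop 5.5 proof p.327 (PDF p.101); Lem 5.9 (v) p.332 (PDF p.106)] -/
theorem isDeltaLeg_of_laws {η : R.PiYdd → R.mu} (hη : η ∈ R.thetaCocycles)
    (hYdd : 𝔉.PiYdd.map ι.toMonoidHom = R.PiYdd) (P : ThetaSubquotientProj 𝔉) (ψ : 𝔉.lDeltaModN 𝔉.BN ≃* R.mu)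
    (hlift : ∀ a ∈ 𝔉.HB, a ∈ P.pre (𝔉.base.obj 𝔉.BN) →
      ∃ k : 𝔉.PiYdd, ι (k : 𝔉.PiX) ∈ R.lDeltaTheta ∧ 𝔉.ρ (k : 𝔉.PiX) = a)
    (hP : ∀ (k : 𝔉.PiYdd) (hk : ι (k : 𝔉.PiX) ∈ R.lDeltaTheta) (hm : 𝔉.ρ (k : 𝔉.PiX) ∈ P.pre (𝔉.base.obj 𝔉.BN)),
      (QuotientGroup.mk (P.proj _ ⟨𝔉.ρ (k : 𝔉.PiX), hm⟩) : 𝔉.lDeltaModN 𝔉.BN) =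
        ψ.symm (R.thetaMod ⟨ι (k : 𝔉.PiX), hk⟩))
    (hdies : ∀ k : R.PiYdd, 𝔉.ρ (ι.symm (k : R.PiX)) = 1 → η k = 1) :
    𝔉.IsDeltaLeg R.toThetaEnvData ι η hYdd P ψ := by
  intro y _ hh
  obtain ⟨k, hk, hρ⟩ := hlift _ (𝔉.rhoYdd y).2 hh
  have hm : 𝔉.ρ (k : 𝔉.PiX) ∈ P.pre (𝔉.base.obj 𝔉.BN) := by rw [hρ]; exact hh
  -- the two elements of the pre-subgroup coincide
  have hel : (⟨((𝔉.rhoYdd y : 𝔉.HB) : Aut (𝔉.base.obj 𝔉.BN)), hh⟩ : P.pre (𝔉.base.obj 𝔉.BN)) =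
      ⟨𝔉.ρ (k : 𝔉.PiX), hm⟩ := Subtype.ext hρ.symm
  rw [hel, hP k hk hm, ψ.apply_symm_apply]
  -- `θ-mod(ι k) = η(ι k)` (the theta and algebraic sections over `l·Δ_Θ`), then fibre-constancy of `η` along `ρ ∘ ι⁻¹`
  refine (R.cocycle_lDeltaTheta η hη ⟨ι (k : 𝔉.PiX), 𝔉.iota_mem_PiYdd R.toThetaEnvData ι hYdd k⟩ hk).symm.trans ?_
  refine R.toThetaEnvData.thetaCocycle_eq_of_map_eq (𝔉.ρ.comp ι.symm.toMulEquiv.toMonoidHom) hη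
    (fun k' hk' => hdies k' hk') _ _ ?_
  change 𝔉.ρ (ι.symm (ι (k : 𝔉.PiX))) = 𝔉.ρ (ι.symm (ι (y : 𝔉.PiX)))
  rw [ι.symm_apply_apply, ι.symm_apply_apply, hρ]
  rfl

/-- **The coverage binder from the row-2 laws** («`Δ_Θ` is a quotient of a subgroup of `Π^tp_Ÿ`», §1 p.238; the
argument of w5-d123's `lDeltaCovered_ofBiKummerData` for an arbitrary §5 datum): if (hpre) `ρ k` lies in the theta
pre-subgroup for `k ∈ Π^tp_Ÿ̲` with `ι k ∈ θ⁻¹(l·Δ_Θ)` and (hP) holds there, EVERY class of `(l·Δ_Θ)_{B_N} ⊗ ℤ/Nℤ` is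
`[P.proj(ρ y)]` for some `y ∈ Π^tp_Ÿ̲` over `Δ` — by `RigidData.thetaMod_surjective` / `lDeltaTheta_le`.
[cite: MochizukiEtTh2009, §1 p.238 (PDF p.12); Prop 5.5 proof p.327 (PDF p.101)] -/
theorem cover_of_laws (hYdd : 𝔉.PiYdd.map ι.toMonoidHom = R.PiYdd) (P : ThetaSubquotientProj 𝔉)
    (ψ : 𝔉.lDeltaModN 𝔉.BN ≃* R.mu)
    (hpre : ∀ k : 𝔉.PiYdd, ι (k : 𝔉.PiX) ∈ R.lDeltaTheta → 𝔉.ρ (k : 𝔉.PiX) ∈ P.pre (𝔉.base.obj 𝔉.BN))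
    (hP : ∀ (k : 𝔉.PiYdd) (hk : ι (k : 𝔉.PiX) ∈ R.lDeltaTheta) (hm : 𝔉.ρ (k : 𝔉.PiX) ∈ P.pre (𝔉.base.obj 𝔉.BN)),
      (QuotientGroup.mk (P.proj _ ⟨𝔉.ρ (k : 𝔉.PiX), hm⟩) : 𝔉.lDeltaModN 𝔉.BN) =
        ψ.symm (R.thetaMod ⟨ι (k : 𝔉.PiX), hk⟩))
    (x : 𝔉.lDeltaModN 𝔉.BN) :
    ∃ (y : 𝔉.PiYdd) (_ : R.aug (ι (y : 𝔉.PiX)) = 1)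
      (hh : ((𝔉.rhoYdd y : 𝔉.HB) : Aut (𝔉.base.obj 𝔉.BN)) ∈ P.pre (𝔉.base.obj 𝔉.BN)),
      (QuotientGroup.mk (P.proj _ ⟨_, hh⟩) : 𝔉.lDeltaModN 𝔉.BN) = x := by
  obtain ⟨g, hg⟩ := R.thetaMod_surjective (ψ x)
  -- `g ∈ θ⁻¹(l·Δ_Θ) ⊆ Π^tp_Ÿ ∩ Ker aug`; pull back along `ι`
  have hgY : (g : R.PiX) ∈ R.PiYdd := (Subgroup.mem_inf.mp (R.lDeltaTheta_le g.2)).1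
  have hgaug : R.aug (g : R.PiX) = 1 := (Subgroup.mem_inf.mp (R.lDeltaTheta_le g.2)).2
  let y : 𝔉.PiYdd := ⟨ι.symm (g : R.PiX), 𝔉.iota_symm_mem_PiYdd R ι hYdd ⟨_, hgY⟩⟩
  have hιy : ι (y : 𝔉.PiX) = (g : R.PiX) := ι.apply_symm_apply _
  have hk : ι (y : 𝔉.PiX) ∈ R.lDeltaTheta := by rw [hιy]; exact g.2
  have hgk : (⟨ι (y : 𝔉.PiX), hk⟩ : R.lDeltaTheta) = g := Subtype.ext hιy
  refine ⟨y, by rw [hιy]; exact hgaug, hpre y hk, (hP y hk (hpre y hk)).trans ?_⟩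
  rw [hgk, hg, ψ.symm_apply_apply]

/-- **[EtTh] Lemma 5.9 (v) with the §2 slot PINNED, from the row-2 laws**: Prop. 5.5 BY NAME (`IsKummerDetermined`) +
(hpre, hlift, hP) (the laws of the real theta subquotient datum at `B_N^bs`, MERGE-PLAN row 2) + (hdies) («`B_N` is an
`l·N`-codomain») + the bi-theta isomorphism of Lemma 5.9 (iv) ⟹ `CycRigidityCoincide (rho219OfBiTheta …) ρ hB` — the
same binder list as the Prop. 5.5 / Thm. 5.6 (i) chain of abc-iut-w5-d020 / w5-d123.
[cite: MochizukiEtTh2009, Lem 5.9 (v) p.332 (PDF p.106)] -/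
theorem cycRigidityCoincide_rho219OfBiTheta_of_laws {η : R.PiYdd → R.mu} (hη : η ∈ R.thetaCocycles)
    (i : (𝔉.frdBiThetaEnv h1 h3 hsec hcs h8 DK).Iso (R.toThetaEnvData.modelBi hη))
    (hi : ∀ x : 𝔉.EPiN, ((CycEnvelope.proj R.augY R.chi (i.e x) : R.PiY) : R.PiX) = ι (𝔉.toPiY x))
    (hYdd : 𝔉.PiYdd.map ι.toMonoidHom = R.PiYdd) (P : ThetaSubquotientProj 𝔉)
    (ρf : RigidityFamily 𝔉) (hB : 𝔉.IsThetaSaturated 𝔉.BN) (hρf : IsKummerDetermined 𝔉 P ρf hB)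
    (ψ : 𝔉.lDeltaModN 𝔉.BN ≃* R.mu)
    (hpre : ∀ k : 𝔉.PiYdd, ι (k : 𝔉.PiX) ∈ R.lDeltaTheta → 𝔉.ρ (k : 𝔉.PiX) ∈ P.pre (𝔉.base.obj 𝔉.BN))
    (hlift : ∀ a ∈ 𝔉.HB, a ∈ P.pre (𝔉.base.obj 𝔉.BN) →
      ∃ k : 𝔉.PiYdd, ι (k : 𝔉.PiX) ∈ R.lDeltaTheta ∧ 𝔉.ρ (k : 𝔉.PiX) = a)
    (hP : ∀ (k : 𝔉.PiYdd) (hk : ι (k : 𝔉.PiX) ∈ R.lDeltaTheta) (hm : 𝔉.ρ (k : 𝔉.PiX) ∈ P.pre (𝔉.base.obj 𝔉.BN)),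
      (QuotientGroup.mk (P.proj _ ⟨𝔉.ρ (k : 𝔉.PiX), hm⟩) : 𝔉.lDeltaModN 𝔉.BN) =
        ψ.symm (R.thetaMod ⟨ι (k : 𝔉.PiX), hk⟩))
    (hdies : ∀ k : R.PiYdd, 𝔉.ρ (ι.symm (k : R.PiX)) = 1 → η k = 1) :
    𝔉.CycRigidityCoincide (𝔉.rho219OfBiTheta h1 h3 hsec hcs h8 DK R.toThetaEnvData ι hη i hi ψ) ρf hB :=
  𝔉.cycRigidityCoincide_rho219OfBiTheta h1 h3 hsec hcs h8 DK R.toThetaEnvData ι hη i hi hYdd P ρf hB hρf ψ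
    (𝔉.isDeltaLeg_of_laws R ι hη hYdd P ψ hlift hP hdies) (𝔉.cover_of_laws R ι hYdd P ψ hpre hP)

/-! ## The binder `hdies` OVER `Δ` is a CONSEQUENCE of the bi-theta isomorphism of Lemma 5.9 (iv)

(appended, abc-iut-w4-d042 gen 2.)  For `y ∈ Π^tp_Ÿ̲` over `Δ` with `ρ y = 1` the bi-Kummer difference
`s^⊓-Π_N(y) · s^⊔-Π_N(y)⁻¹ = (s^⊓-gp_N(1) · s^⊔-gp_N(1)⁻¹, 1)` is trivial, and the isomorphism of (iv) carries it to
`μ(η(ι y))` (`biThetaIso_sCapPi_mul_sCupPi_inv`, p417589); so `η(ι y) = 1`.  Hence the `Δ`-part of GAP G-w5d123-1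
(«the mod-`N` theta cocycle dies on `Ker ρ ∩ Π^tp_Ÿ̲`») holds at ANY §5 datum admitting the bi-theta isomorphism, the
theta cocycle is constant on the `ρ`-fibres of `Π^tp_Ÿ̲ ∩ Δ`, and the `Δ`-leg law needs the row-2 laws ONLY. -/

/-- **`η` dies on `ι(Ker ρ ∩ Π^tp_Ÿ̲)` over `Δ`, by Lemma 5.9 (iv).**  For `y ∈ Π^tp_Ÿ̲` with `aug(ι y) = 1` and `ρ y = 1`:
`s^⊓-Π_N(y) · s^⊔-Π_N(y)⁻¹ = 1` in `E^Π_N` (its `Aut_C(B_N)`-component is `s^⊓-gp_N(1) · s^⊔-gp_N(1)⁻¹ = 1`, and it lies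
in `μ_N(B_N)`), while the bi-theta isomorphism carries it to `μ(η(ι y))`; `μ ↪ Π^tp_Y[μ_N]` is injective.  This is the
`Δ`-part of the binder `hdies` (GAP G-w5d123-1) — DISCHARGED here from the isomorphism of (iv) alone.
[cite: MochizukiEtTh2009, Lem 5.9 (iv)/(v) p.332 (PDF p.106); Prop 5.2 (iii) p.324 (PDF p.98)] -/
theorem biThetaIso_eta_eq_one_of_rho_eq_one (T : ThetaEnvData.{v} 𝔉.N) (ι : 𝔉.PiX ≃ₜ* T.PiX)
    {η : T.PiYdd → T.mu} (hη : η ∈ T.thetaCocycles)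
    (i : (𝔉.frdBiThetaEnv h1 h3 hsec hcs h8 DK).Iso (T.modelBi hη))
    (hi : ∀ x : 𝔉.EPiN, ((CycEnvelope.proj T.augY T.chi (i.e x) : T.PiY) : T.PiX) = ι (𝔉.toPiY x))
    (hYdd : 𝔉.PiYdd.map ι.toMonoidHom = T.PiYdd) (y : 𝔉.PiYdd) (hy : T.aug (ι (y : 𝔉.PiX)) = 1)
    (hρ : 𝔉.ρ (y : 𝔉.PiX) = 1) :
    η ⟨ι (y : 𝔉.PiX), 𝔉.iota_mem_PiYdd T ι hYdd y⟩ = 1 := by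
  have h := 𝔉.biThetaIso_sCapPi_mul_sCupPi_inv h1 h3 hsec hcs h8 DK T ι hη i hi hYdd y hy
  -- the bi-Kummer difference at `y` is trivial: it is `μ(u)` with `u = s^⊓-gp_N(ρ y) · s^⊔-gp_N(ρ y)⁻¹ = 1`
  have hcap : 𝔉.sgpCap (𝔉.ρ (y : 𝔉.PiX)) = 1 := by rw [hρ, map_one]
  have hcup : 𝔉.sgpCup (𝔉.rhoYdd y) = 1 := by
    have hYdd1 : 𝔉.rhoYdd y = 1 := Subtype.ext hρ
    rw [hYdd1]
    exact map_one _
  have hone : i.e (𝔉.sCapPi hsec y * (𝔉.sCupPi h1 hcs y)⁻¹) = 1 := by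
    obtain ⟨u, hu⟩ := 𝔉.sCapPi_mul_sCupPi_inv_mem_range_muIncl h1 hsec hcs y
    have hfst := congrArg Prod.fst (congrArg (fun e : 𝔉.EPiN => (e : Aut 𝔉.BN × 𝔉.PiX)) hu)
    rw [coe_muIncl, coe_sCapPi_mul_sCupPi_inv_fst] at hfst
    change (u : Aut 𝔉.BN) = 𝔉.sgpCap (𝔉.ρ (y : 𝔉.PiX)) * (𝔉.sgpCup (𝔉.rhoYdd y))⁻¹ at hfst
    rw [hcap, hcup, inv_one, mul_one] at hfst
    have hu1 : u = 1 := Subtype.ext hfst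
    rw [← hu, hu1, map_one]
    exact map_one i.e
  have h' : CycEnvelope.inMu T.augY T.chi (η ⟨ι (y : 𝔉.PiX), 𝔉.iota_mem_PiYdd T ι hYdd y⟩) =
      CycEnvelope.inMu T.augY T.chi 1 := by
    rw [map_one, ← h, hone]
  exact SemidirectProduct.inl_injective h'

/-- **The theta cocycle is constant on the `ρ`-fibres of `Π^tp_Ÿ̲ ∩ Δ`** (given the bi-theta isomorphism of (iv)): for
`y₁, y₂ ∈ Π^tp_Ÿ̲` over `Δ` with `ρ y₁ = ρ y₂`, `η(ι y₁) = η(ι y₂)` — the cocycle law at `(ι y₁, ι(y₁⁻¹ y₂))`, the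
character `χ` being idle over `Δ`, and `biThetaIso_eta_eq_one_of_rho_eq_one` at `y₁⁻¹ y₂`.
[cite: MochizukiEtTh2009, Prop 5.2 (iii) p.324 (PDF p.98); Lem 5.9 (v) p.332 (PDF p.106)] -/
theorem biThetaIso_eta_eq_of_rho_eq (T : ThetaEnvData.{v} 𝔉.N) (ι : 𝔉.PiX ≃ₜ* T.PiX)
    {η : T.PiYdd → T.mu} (hη : η ∈ T.thetaCocycles)
    (i : (𝔉.frdBiThetaEnv h1 h3 hsec hcs h8 DK).Iso (T.modelBi hη))
    (hi : ∀ x : 𝔉.EPiN, ((CycEnvelope.proj T.augY T.chi (i.e x) : T.PiY) : T.PiX) = ι (𝔉.toPiY x))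
    (hYdd : 𝔉.PiYdd.map ι.toMonoidHom = T.PiYdd) (y₁ y₂ : 𝔉.PiYdd) (hy₁ : T.aug (ι (y₁ : 𝔉.PiX)) = 1)
    (hy₂ : T.aug (ι (y₂ : 𝔉.PiX)) = 1) (hρ : 𝔉.ρ (y₁ : 𝔉.PiX) = 𝔉.ρ (y₂ : 𝔉.PiX)) :
    η ⟨ι (y₁ : 𝔉.PiX), 𝔉.iota_mem_PiYdd T ι hYdd y₁⟩ = η ⟨ι (y₂ : 𝔉.PiX), 𝔉.iota_mem_PiYdd T ι hYdd y₂⟩ := by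
  have hρ' : 𝔉.ρ ((y₁⁻¹ * y₂ : 𝔉.PiYdd) : 𝔉.PiX) = 1 := by
    rw [Subgroup.coe_mul, Subgroup.coe_inv, map_mul, map_inv, hρ, inv_mul_cancel]
  have hy' : T.aug (ι ((y₁⁻¹ * y₂ : 𝔉.PiYdd) : 𝔉.PiX)) = 1 := by
    rw [Subgroup.coe_mul, Subgroup.coe_inv, map_mul, map_inv, map_mul, map_inv, hy₁, hy₂, inv_one, mul_one]
  have hd := 𝔉.biThetaIso_eta_eq_one_of_rho_eq_one h1 h3 hsec hcs h8 DK T ι hη i hi hYdd (y₁⁻¹ * y₂) hy' hρ'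
  -- `ι y₂ = ι y₁ · ι(y₁⁻¹ y₂)` in `Π^tp_Ÿ`
  have hprod : (⟨ι (y₂ : 𝔉.PiX), 𝔉.iota_mem_PiYdd T ι hYdd y₂⟩ : T.PiYdd) =
      ⟨ι (y₁ : 𝔉.PiX), 𝔉.iota_mem_PiYdd T ι hYdd y₁⟩ *
        ⟨ι ((y₁⁻¹ * y₂ : 𝔉.PiYdd) : 𝔉.PiX), 𝔉.iota_mem_PiYdd T ι hYdd (y₁⁻¹ * y₂)⟩ := by
    apply Subtype.ext
    change ι (y₂ : 𝔉.PiX) = ι (y₁ : 𝔉.PiX) * ι ((y₁⁻¹ * y₂ : 𝔉.PiYdd) : 𝔉.PiX)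
    rw [← map_mul, Subgroup.coe_mul, Subgroup.coe_inv, mul_inv_cancel_left]
  have hlaw := T.isCocycle η hη ⟨ι (y₁ : 𝔉.PiX), 𝔉.iota_mem_PiYdd T ι hYdd y₁⟩
    ⟨ι ((y₁⁻¹ * y₂ : 𝔉.PiYdd) : 𝔉.PiX), 𝔉.iota_mem_PiYdd T ι hYdd (y₁⁻¹ * y₂)⟩
  rw [← hprod, hd, map_one, mul_one] at hlaw
  exact hlaw.symm

/-- **The `Δ`-leg law from the row-2 laws ALONE**, given the bi-theta isomorphism of Lemma 5.9 (iv): (hlift) + (hP)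
⟹ `IsDeltaLeg ι η P ψ` — as `isDeltaLeg_of_laws`, with the fibre-constancy supplied by `biThetaIso_eta_eq_of_rho_eq`
instead of the binder `hdies`. [cite: MochizukiEtTh2009, Lem 5.9 (v) p.332 (PDF p.106); Prop 5.5 proof p.327 (PDF p.101)] -/
theorem isDeltaLeg_of_rowTwo {η : R.PiYdd → R.mu} (hη : η ∈ R.thetaCocycles)
    (i : (𝔉.frdBiThetaEnv h1 h3 hsec hcs h8 DK).Iso (R.toThetaEnvData.modelBi hη))
    (hi : ∀ x : 𝔉.EPiN, ((CycEnvelope.proj R.augY R.chi (i.e x) : R.PiY) : R.PiX) = ι (𝔉.toPiY x))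
    (hYdd : 𝔉.PiYdd.map ι.toMonoidHom = R.PiYdd) (P : ThetaSubquotientProj 𝔉) (ψ : 𝔉.lDeltaModN 𝔉.BN ≃* R.mu)
    (hlift : ∀ a ∈ 𝔉.HB, a ∈ P.pre (𝔉.base.obj 𝔉.BN) →
      ∃ k : 𝔉.PiYdd, ι (k : 𝔉.PiX) ∈ R.lDeltaTheta ∧ 𝔉.ρ (k : 𝔉.PiX) = a)
    (hP : ∀ (k : 𝔉.PiYdd) (hk : ι (k : 𝔉.PiX) ∈ R.lDeltaTheta) (hm : 𝔉.ρ (k : 𝔉.PiX) ∈ P.pre (𝔉.base.obj 𝔉.BN)),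
      (QuotientGroup.mk (P.proj _ ⟨𝔉.ρ (k : 𝔉.PiX), hm⟩) : 𝔉.lDeltaModN 𝔉.BN) =
        ψ.symm (R.thetaMod ⟨ι (k : 𝔉.PiX), hk⟩)) :
    𝔉.IsDeltaLeg R.toThetaEnvData ι η hYdd P ψ := by
  intro y hy hh
  obtain ⟨k, hk, hρ⟩ := hlift _ (𝔉.rhoYdd y).2 hh
  have hm : 𝔉.ρ (k : 𝔉.PiX) ∈ P.pre (𝔉.base.obj 𝔉.BN) := by rw [hρ]; exact hh
  have hel : (⟨((𝔉.rhoYdd y : 𝔉.HB) : Aut (𝔉.base.obj 𝔉.BN)), hh⟩ : P.pre (𝔉.base.obj 𝔉.BN)) =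
      ⟨𝔉.ρ (k : 𝔉.PiX), hm⟩ := Subtype.ext hρ.symm
  rw [hel, hP k hk hm, ψ.apply_symm_apply]
  refine (R.cocycle_lDeltaTheta η hη ⟨ι (k : 𝔉.PiX), 𝔉.iota_mem_PiYdd R.toThetaEnvData ι hYdd k⟩ hk).symm.trans ?_
  exact 𝔉.biThetaIso_eta_eq_of_rho_eq h1 h3 hsec hcs h8 DK R.toThetaEnvData ι hη i hi hYdd k y
    (Subgroup.mem_inf.mp (R.lDeltaTheta_le hk)).2 hy hρ

/-- **[EtTh] Lemma 5.9 (v) with the §2 slot PINNED, from Prop. 5.5 BY NAME + the row-2 laws ONLY**: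
`IsKummerDetermined` + (hpre, hlift, hP) + the bi-theta isomorphism of (iv) ⟹ `CycRigidityCoincide (rho219OfBiTheta …) ρ hB`
— the binder `hdies` of `cycRigidityCoincide_rho219OfBiTheta_of_laws` is GONE (its `Δ`-part is a theorem, see above).
Residual named inputs of the pinned Lemma 5.9 (v): Prop. 5.5 (`IsKummerDetermined`), MERGE-PLAN row 2 (GAP G-w5d123-2:
`hpre`/`hlift`/`hP` for the real theta subquotient datum), Lemma 5.9 (iv) (`EnvIsoBiTheta`, discharged by L2).
[cite: MochizukiEtTh2009, Lem 5.9 (v) p.332 (PDF p.106)] -/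
theorem cycRigidityCoincide_rho219OfBiTheta_of_rowTwo {η : R.PiYdd → R.mu} (hη : η ∈ R.thetaCocycles)
    (i : (𝔉.frdBiThetaEnv h1 h3 hsec hcs h8 DK).Iso (R.toThetaEnvData.modelBi hη))
    (hi : ∀ x : 𝔉.EPiN, ((CycEnvelope.proj R.augY R.chi (i.e x) : R.PiY) : R.PiX) = ι (𝔉.toPiY x))
    (hYdd : 𝔉.PiYdd.map ι.toMonoidHom = R.PiYdd) (P : ThetaSubquotientProj 𝔉)
    (ρf : RigidityFamily 𝔉) (hB : 𝔉.IsThetaSaturated 𝔉.BN) (hρf : IsKummerDetermined 𝔉 P ρf hB)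
    (ψ : 𝔉.lDeltaModN 𝔉.BN ≃* R.mu)
    (hpre : ∀ k : 𝔉.PiYdd, ι (k : 𝔉.PiX) ∈ R.lDeltaTheta → 𝔉.ρ (k : 𝔉.PiX) ∈ P.pre (𝔉.base.obj 𝔉.BN))
    (hlift : ∀ a ∈ 𝔉.HB, a ∈ P.pre (𝔉.base.obj 𝔉.BN) →
      ∃ k : 𝔉.PiYdd, ι (k : 𝔉.PiX) ∈ R.lDeltaTheta ∧ 𝔉.ρ (k : 𝔉.PiX) = a)
    (hP : ∀ (k : 𝔉.PiYdd) (hk : ι (k : 𝔉.PiX) ∈ R.lDeltaTheta) (hm : 𝔉.ρ (k : 𝔉.PiX) ∈ P.pre (𝔉.base.obj 𝔉.BN)),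
      (QuotientGroup.mk (P.proj _ ⟨𝔉.ρ (k : 𝔉.PiX), hm⟩) : 𝔉.lDeltaModN 𝔉.BN) =
        ψ.symm (R.thetaMod ⟨ι (k : 𝔉.PiX), hk⟩)) :
    𝔉.CycRigidityCoincide (𝔉.rho219OfBiTheta h1 h3 hsec hcs h8 DK R.toThetaEnvData ι hη i hi ψ) ρf hB :=
  𝔉.cycRigidityCoincide_rho219OfBiTheta h1 h3 hsec hcs h8 DK R.toThetaEnvData ι hη i hi hYdd P ρf hB hρf ψ
    (𝔉.isDeltaLeg_of_rowTwo h1 h3 hsec hcs h8 DK R ι hη i hi hYdd P ψ hlift hP) (𝔉.cover_of_laws R ι hYdd P ψ hpre hP)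

end ThetaFrobenioid

end Literature.AnabelianGeometry.EtaleTheta

end
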